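import Literature.Geometry.Lorentzian.KerrSchildEnergyEstimate

/-!
# Crux `AdiabaticMultiKerrILED` (line `Sketch`) — propagation of spatial decay under finite energy

Helper file for the crux `stmt-FinalStateConjecture-14310`
(`Summit.FinalStateConjecture.FinalStateConjecture.Theses.ClusterCompleteness.AdiabaticMultiKerrILED`),
far-field stub `stub_farTransport`: the solution is normalised at `t = 0` by its constant at spatial
infinity (`ψ(0,·) − c` in the Hardy class far out); the Morawetz boundary terms at a later time `t`
need the same decay for `ψ(t,·) − c`. This file proves the elementary propagation estimate

  `∫_{ρ < ‖y‖} (ψ(t, y) − ψ(0, y))² / ‖y‖² dy ≤ (t/ρ²) ∫_0^t ∫_{ρ < ‖y‖} (∂ₜψ)(s, y)² dy ds`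

for `ψ ∈ C¹(ℝ⁴)`, `t ≥ 0`, `ρ > 0` (fundamental theorem of calculus along `s ↦ (s, y)`, the
Cauchy–Schwarz inequality `(∫_0^t f)² ≤ t ∫_0^t f²`, Tonelli), in `[0, ∞]`-valued form. [folklore]
-/

noncomputable section

-- the doubled `FinalStateConjecture.FinalStateConjecture` path component trips dupNamespace
set_option linter.dupNamespace false

open scoped ContDiff Topology ENNReal
open Filter Set MeasureTheory Literature.Geometry.Lorentzian

namespace Summit.FinalStateConjecture.FinalStateConjecture.Cruxes.AdiabaticMultiKerrILED.Sketch

/-! ### Cauchy–Schwarz on an interval in the form `(∫ f)² ≤ t ∫ f²` -/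

/-- **`(∫_0^t f)² ≤ t ∫_0^t f²`** for `f` continuous on `[0, t]`, `0 ≤ t` (expand
`0 ≤ ∫_0^t (f − m)²` with `m` the mean of `f`). [folklore] -/
theorem sq_integral_le_mul_integral_sq {f : ℝ → ℝ} {t : ℝ} (ht : 0 ≤ t)
    (hf : ContinuousOn f (Icc 0 t)) :
    (∫ s in (0 : ℝ)..t, f s) ^ 2 ≤ t * ∫ s in (0 : ℝ)..t, f s ^ 2 := by
  rcases ht.eq_or_lt with rfl | htpos
  · simp
  have hfi : IntervalIntegrable f volume 0 t := (hf.mono (by rw [uIcc_of_le ht])).intervalIntegrable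
  have hf2 : ContinuousOn (fun s ↦ f s ^ 2) (Icc 0 t) := hf.pow 2
  have hf2i : IntervalIntegrable (fun s ↦ f s ^ 2) volume 0 t :=
    (hf2.mono (by rw [uIcc_of_le ht])).intervalIntegrable
  set I := ∫ s in (0 : ℝ)..t, f s with hI
  set m := I / t with hm
  -- `0 ≤ ∫ (f - m)² = ∫ f² - 2 m I + m² t`
  have hnn : 0 ≤ ∫ s in (0 : ℝ)..t, (f s - m) ^ 2 :=
    intervalIntegral.integral_nonneg ht fun s _ ↦ sq_nonneg _
  have hexp : ∫ s in (0 : ℝ)..t, (f s - m) ^ 2 =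
      (∫ s in (0 : ℝ)..t, f s ^ 2) - 2 * m * I + m ^ 2 * t := by
    have h1 : (fun s ↦ (f s - m) ^ 2) = fun s ↦ f s ^ 2 - (2 * m) * f s + m ^ 2 := by
      funext s; ring
    rw [h1, intervalIntegral.integral_add, intervalIntegral.integral_sub hf2i (hfi.const_mul _),
      intervalIntegral.integral_const_mul, intervalIntegral.integral_const]
    · simp only [sub_zero, smul_eq_mul, hI]
      ring
    · exact hf2i.sub (hfi.const_mul _)
    · exact intervalIntegrable_const
  rw [hexp, hm] at hnn
  have key : 0 ≤ (∫ s in (0 : ℝ)..t, f s ^ 2) - I ^ 2 / t := by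
    have : (∫ s in (0 : ℝ)..t, f s ^ 2) - 2 * (I / t) * I + (I / t) ^ 2 * t =
        (∫ s in (0 : ℝ)..t, f s ^ 2) - I ^ 2 / t := by
      field_simp
      ring
    linarith [this]
  have h2 : I ^ 2 / t ≤ ∫ s in (0 : ℝ)..t, f s ^ 2 := by linarith
  calc I ^ 2 = t * (I ^ 2 / t) := by field_simp
    _ ≤ t * ∫ s in (0 : ℝ)..t, f s ^ 2 := mul_le_mul_of_nonneg_left h2 ht

/-! ### The time difference along a slice point -/

/-- **`ψ(t, y) − ψ(0, y) = ∫_0^t (∂ₜψ)(s, y) ds`** for `ψ ∈ C¹(ℝ⁴)` (FTC along `s ↦ (s, y)`).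
[folklore] -/
theorem sub_eq_integral_fderiv {ψ : E4 → ℝ} (hψ : ContDiff ℝ 1 ψ) (t : ℝ) (y : E3) :
    ψ (E4.ofTimeSpace t y) - ψ (E4.ofTimeSpace 0 y) =
      ∫ s in (0 : ℝ)..t, fderiv ℝ ψ (E4.ofTimeSpace s y) (E4.basisVector 0) := by
  have hd : ∀ s, HasDerivAt (fun σ ↦ ψ (E4.ofTimeSpace σ y))
      (fderiv ℝ ψ (E4.ofTimeSpace s y) (E4.basisVector 0)) s := fun s ↦ by
    have h1 := (hψ.differentiable one_ne_zero (E4.ofTimeSpace s y)).hasFDerivAt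
    have h2 := E4.hasDerivAt_ofTimeSpace_left s y
    exact h1.comp_hasDerivAt s h2
  have hcont : Continuous fun s ↦ fderiv ℝ ψ (E4.ofTimeSpace s y) (E4.basisVector 0) :=
    ((hψ.continuous_fderiv one_ne_zero).comp
      (E4.continuous_ofTimeSpace_uncurry.comp (continuous_id.prodMk continuous_const))).clm_apply
      continuous_const
  rw [intervalIntegral.integral_eq_sub_of_hasDerivAt (fun s _ ↦ hd s) (hcont.intervalIntegrable _ _)]

/-- Pointwise estimate: for `‖y‖ > ρ > 0` and `t ≥ 0`,
`(ψ(t,y) − ψ(0,y))²/‖y‖² ≤ (t/ρ²) ∫_0^t (∂ₜψ)(s,y)² ds`. [folklore] -/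
theorem sq_sub_div_norm_sq_le {ψ : E4 → ℝ} (hψ : ContDiff ℝ 1 ψ) {t ρ : ℝ} (ht : 0 ≤ t)
    (hρ : 0 < ρ) {y : E3} (hy : ρ < ‖y‖) :
    (ψ (E4.ofTimeSpace t y) - ψ (E4.ofTimeSpace 0 y)) ^ 2 / ‖y‖ ^ 2 ≤
      t / ρ ^ 2 * ∫ s in (0 : ℝ)..t, (fderiv ℝ ψ (E4.ofTimeSpace s y) (E4.basisVector 0)) ^ 2 := by
  have hcont : Continuous fun s ↦ fderiv ℝ ψ (E4.ofTimeSpace s y) (E4.basisVector 0) :=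
    ((hψ.continuous_fderiv one_ne_zero).comp
      (E4.continuous_ofTimeSpace_uncurry.comp (continuous_id.prodMk continuous_const))).clm_apply
      continuous_const
  have hcs := sq_integral_le_mul_integral_sq ht hcont.continuousOn
  rw [← sub_eq_integral_fderiv hψ t y] at hcs
  have hy0 : 0 < ‖y‖ := hρ.trans hy
  have hint_nn : 0 ≤ ∫ s in (0 : ℝ)..t, (fderiv ℝ ψ (E4.ofTimeSpace s y) (E4.basisVector 0)) ^ 2 :=
    intervalIntegral.integral_nonneg ht fun s _ ↦ sq_nonneg _
  rw [div_le_iff₀ (by positivity)]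
  calc (ψ (E4.ofTimeSpace t y) - ψ (E4.ofTimeSpace 0 y)) ^ 2
      ≤ t * ∫ s in (0 : ℝ)..t, (fderiv ℝ ψ (E4.ofTimeSpace s y) (E4.basisVector 0)) ^ 2 := hcs
    _ = t / ρ ^ 2 * (∫ s in (0 : ℝ)..t,
          (fderiv ℝ ψ (E4.ofTimeSpace s y) (E4.basisVector 0)) ^ 2) * ρ ^ 2 := by
        field_simp
    _ ≤ t / ρ ^ 2 * (∫ s in (0 : ℝ)..t,
          (fderiv ℝ ψ (E4.ofTimeSpace s y) (E4.basisVector 0)) ^ 2) * ‖y‖ ^ 2 := by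
        have : ρ ^ 2 ≤ ‖y‖ ^ 2 := pow_le_pow_left₀ hρ.le hy.le 2
        have hc : 0 ≤ t / ρ ^ 2 * ∫ s in (0 : ℝ)..t,
            (fderiv ℝ ψ (E4.ofTimeSpace s y) (E4.basisVector 0)) ^ 2 := by positivity
        exact mul_le_mul_of_nonneg_left this hc

/-! ### The integrated propagation estimate -/

/-- **Propagation of Hardy-class decay under finite energy.** For `ψ ∈ C¹(ℝ⁴)`, `t ≥ 0`, `ρ > 0`:
`∫_{ρ<‖y‖} (ψ(t,y) − ψ(0,y))²/‖y‖² ≤ (t/ρ²) ∫_{s ∈ (0,t)} ∫_{ρ<‖y‖} (∂ₜψ)(s,y)²`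
(`[0, ∞]`-valued; the right side is at most `t²/ρ²` times the supremum of the exterior energies).
[folklore] -/
theorem lintegral_sq_sub_div_norm_sq_le {ψ : E4 → ℝ} (hψ : ContDiff ℝ 1 ψ) {t ρ : ℝ} (ht : 0 ≤ t)
    (hρ : 0 < ρ) :
    ∫⁻ y in {y : E3 | ρ < ‖y‖},
        ENNReal.ofReal ((ψ (E4.ofTimeSpace t y) - ψ (E4.ofTimeSpace 0 y)) ^ 2 / ‖y‖ ^ 2) ≤
      ENNReal.ofReal (t / ρ ^ 2) * ∫⁻ s in Ioo (0 : ℝ) t, ∫⁻ y in {y : E3 | ρ < ‖y‖},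
        ENNReal.ofReal ((fderiv ℝ ψ (E4.ofTimeSpace s y) (E4.basisVector 0)) ^ 2) := by
  set F : ℝ → E3 → ℝ := fun s y ↦ (fderiv ℝ ψ (E4.ofTimeSpace s y) (E4.basisVector 0)) ^ 2 with hF
  have hFc : Continuous (Function.uncurry F) := by
    have h1 : Continuous fun q : ℝ × E3 ↦ fderiv ℝ ψ (E4.ofTimeSpace q.1 q.2) (E4.basisVector 0) :=
      ((hψ.continuous_fderiv one_ne_zero).comp E4.continuous_ofTimeSpace_uncurry).clm_apply
        continuous_const
    exact h1.pow 2
  have hFnn : ∀ s y, 0 ≤ F s y := fun s y ↦ sq_nonneg _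
  -- pointwise bound, in `ℝ≥0∞`
  have hpt : ∀ y : E3, ρ < ‖y‖ →
      ENNReal.ofReal ((ψ (E4.ofTimeSpace t y) - ψ (E4.ofTimeSpace 0 y)) ^ 2 / ‖y‖ ^ 2) ≤
        ENNReal.ofReal (t / ρ ^ 2) * ∫⁻ s in Ioo (0 : ℝ) t, ENNReal.ofReal (F s y) := by
    intro y hy
    have h := sq_sub_div_norm_sq_le hψ ht hρ hy
    have hcy : Continuous fun s ↦ F s y := hFc.comp (continuous_id.prodMk continuous_const)
    have hint : (∫ s in (0 : ℝ)..t, F s y) = (∫⁻ s in Ioo (0 : ℝ) t, ENNReal.ofReal (F s y)).toReal := by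
      rw [intervalIntegral.integral_of_le ht, integral_Ioc_eq_integral_Ioo,
        integral_eq_lintegral_of_nonneg_ae (Eventually.of_forall fun s ↦ hFnn s y)
          hcy.aestronglyMeasurable]
    have hfin : (∫⁻ s in Ioo (0 : ℝ) t, ENNReal.ofReal (F s y)) ≠ ⊤ := by
      refine ne_top_of_le_ne_top ?_ (lintegral_mono_set Ioo_subset_Icc_self)
      have hI : IntegrableOn (fun s ↦ F s y) (Icc 0 t) volume :=
        hcy.continuousOn.integrableOn_compact isCompact_Icc
      exact hI.setLIntegral_lt_top.ne
    calc ENNReal.ofReal ((ψ (E4.ofTimeSpace t y) - ψ (E4.ofTimeSpace 0 y)) ^ 2 / ‖y‖ ^ 2)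
        ≤ ENNReal.ofReal (t / ρ ^ 2 * ∫ s in (0 : ℝ)..t, F s y) := ENNReal.ofReal_le_ofReal h
      _ = ENNReal.ofReal (t / ρ ^ 2) * ENNReal.ofReal (∫ s in (0 : ℝ)..t, F s y) :=
          ENNReal.ofReal_mul (by positivity)
      _ = ENNReal.ofReal (t / ρ ^ 2) * ∫⁻ s in Ioo (0 : ℝ) t, ENNReal.ofReal (F s y) := by
          rw [hint, ENNReal.ofReal_toReal hfin]
  -- integrate and swap
  have hmeas : Measurable fun q : ℝ × E3 ↦ ENNReal.ofReal (F q.1 q.2) :=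
    ENNReal.measurable_ofReal.comp hFc.measurable
  calc ∫⁻ y in {y : E3 | ρ < ‖y‖},
        ENNReal.ofReal ((ψ (E4.ofTimeSpace t y) - ψ (E4.ofTimeSpace 0 y)) ^ 2 / ‖y‖ ^ 2)
      ≤ ∫⁻ y in {y : E3 | ρ < ‖y‖},
          ENNReal.ofReal (t / ρ ^ 2) * ∫⁻ s in Ioo (0 : ℝ) t, ENNReal.ofReal (F s y) :=
        setLIntegral_mono' (isOpen_lt continuous_const continuous_norm).measurableSet
          fun y hy ↦ hpt y hy
    _ = ENNReal.ofReal (t / ρ ^ 2) * ∫⁻ y in {y : E3 | ρ < ‖y‖},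
          ∫⁻ s in Ioo (0 : ℝ) t, ENNReal.ofReal (F s y) := by
        rw [lintegral_const_mul']
        exact ENNReal.ofReal_ne_top
    _ = ENNReal.ofReal (t / ρ ^ 2) * ∫⁻ s in Ioo (0 : ℝ) t, ∫⁻ y in {y : E3 | ρ < ‖y‖},
          ENNReal.ofReal (F s y) := by
        congr 1
        rw [lintegral_lintegral_swap]
        exact (hmeas.comp measurable_swap).aemeasurable
end Summit.FinalStateConjecture.FinalStateConjecture.Cruxes.AdiabaticMultiKerrILED.Sketch

end
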